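import Summits.CriticalPhenomena.SAWScalingLimit.Theses.SAWRestrictionRigidity
import Summits.CriticalPhenomena.SAWScalingLimit.Theses.SAWLoopFugacityFlow
import Summits.CriticalPhenomena.SAWScalingLimit.Theorems.IsingBoundaryRatio.Negative.IsingBoundaryRatioNormalisation
import HarnessLib

/-!
# `AvoidanceLimit ⟹ AvoidanceCocycleLimit`: the value-free cocycle crux of route
`SAWRestrictionRigidity` (stmt-CriticalPhenomena-1369) follows from the value-ful avoidance crux of
route `SAWLoopFugacityFlow` (stmt-CriticalPhenomena-10649)

Support file for the crux `LimitExists` (stmt-CriticalPhenomena-1371, line `registered`,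
`Cruxes/LimitExists/Lines/birth.lean`): its registered open stub `stub_avoidanceCocycleLimit` is item
stmt-1369 verbatim, which has no attack of its own, while stmt-10649 (`AvoidanceLimit`: the same lattice
avoidance probability converges to `Φ_A'(0)^{5/8}`) is actively worked (Cruxes/AvoidanceLimit).  This
bridge makes a landing of stmt-10649 propagate to stmt-1369 and hence to `LimitExists` (modulo
`EventualTight` and `SimpleSubseqLimits`).

Proof: for a subdomain `D' ⊆ D` with the same marked points agreeing with `D` in balls about them,
`D'` is a hull subdomain (`IsingBoundaryRatio.Negative.isHullSubdomain_of_conds`); pick a chordal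
uniformizing map `φ : ℍ → D` (`MarkedDomain.exists_isChordalUniformizing_holds`, Riemann +
Carathéodory), the pulled-back `*`-hull `A = φ.pullbackHull D'` (`IsStarHull.pullbackHull`,
`JordanDomain.isSimplyConnected_holds`), its restriction map `Φ_A`
(`IsStarHull.existsUnique_isRestrictionMap_holds`) and derivative number `d = Φ_A'(0)`
(`IsStarHull.exists_hasRestrictionDeriv_holds`); `AvoidanceLimit` then gives the limit
`ENNReal.ofReal (d ^ (5/8))`, a witness for the `∃ c` of `AvoidanceCocycleLimit`.  All inputs are
theorems of the tree; nothing is assumed.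
-/

noncomputable section

open Filter Topology Set
open Literature.Probability.RandomPlanarGeometry Literature.Probability.LatticeModels
open UpperHalfPlane (upperHalfPlaneSet)

namespace Summit.CriticalPhenomena.SAWScalingLimit.Theorems.SAWRestrictionRigidityLimitExists

/-- **`AvoidanceLimit → AvoidanceCocycleLimit`** (stmt-10649 ⟹ stmt-1369): the value-ful avoidance
crux of route `SAWLoopFugacityFlow` implies the value-free cocycle crux of route
`SAWRestrictionRigidity`, by instantiating the conformal variables `(φ, A, Φ, d)` of `AvoidanceLimit`
with the tree's existence theorems (chordal uniformizing map, pulled-back `*`-hull, restriction map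
and its derivative at `0`). [cite: LawlerSchrammWerner2003Restriction, §2 (2.4) p. 7] -/
theorem avoidanceCocycleLimit_of_avoidanceLimit : Summit.CriticalPhenomena.SAWScalingLimit.Theses.SAWLoopFugacityFlow.AvoidanceLimit → Summit.CriticalPhenomena.SAWScalingLimit.Theses.SAWRestrictionRigidity.AvoidanceCocycleLimit := by
  intro hA D D' a b hab hsub h0 h1 hε
  obtain ⟨φ, hφ⟩ := MarkedDomain.exists_isChordalUniformizing_holds D
  have hD' : D.IsHullSubdomain D' :=
    IsingBoundaryRatio.Negative.isHullSubdomain_of_conds hsub h0 h1 hε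
  have hAst : IsStarHull (φ.pullbackHull D') :=
    IsStarHull.pullbackHull JordanDomain.isSimplyConnected_holds hφ hD'
  obtain ⟨Φ, hΦ, -⟩ := IsStarHull.existsUnique_isRestrictionMap_holds hAst
  obtain ⟨d, -, -, hd⟩ := IsStarHull.exists_hasRestrictionDeriv_holds hAst hΦ
  exact ⟨_, hA D D' a b hab hsub h0 h1 hε φ hφ (φ.pullbackHull D') rfl Φ d hΦ hd⟩

end Summit.CriticalPhenomena.SAWScalingLimit.Theorems.SAWRestrictionRigidityLimitExists
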